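import Summits.AtomisticToContinuum.Crystallization.Theorems.PalmUnimodularRigidityLayeredLawsSelectHcpLocalCongruenceSites

/-!
# Frames agree and propagate (stub `stub_framePropagation`, X2c of line `palm-good-law`, crux
# `ReggeStarCoercivity.DefectFreeCrystallizes`, stmt-AtomisticToContinuum-13603)

Let `s` be a Hägg word and `X : ℤ³ → ℝ³` with `X 0 = 0` carry, at every h-type site `u` (`s (u.1 − 1) ≠ s u.1`),
a label-exact frame against `barlowPos a₀ h₀ s` and, at every c-type site (`s (u.1 − 1) = s u.1`), one against
`barlowPos a₀ (a₀ √(2/3)) s` (the conclusions of X2a / X2b): a linear isometry `A_u` with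
`X w − X u = A_u (R w − R u)` for all ideal contacts `w` of `u` (`dist = 1` in `barlowStacking 1 √(2/3) s`).  Then
there are ONE spacing `h ∈ {h₀, a₀ √(2/3)}` and ONE linear isometry `A` with `X u = A (barlowPos a₀ h s u)` for
all `u` (`stub_framePropagation`):

* `strut_eq_siteVec`, `dist_eq_one_of_strut`: every strut is a lattice vector `siteVec a h n`,
  `n = (2Δi + Δj + ΔL, 3Δj + ΔL, Δk)`, for EVERY spacing, and `u ~ w` as soon as `3 n₁² + n₂² + 8 n₃² = 12`;
* `frame_agree_of` (+ `_vert`, `_axis₁`, `_axis₂`): along a contact with two common contacts completing the bond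
  to a lattice triple of non-zero determinant the frames agree (`linearMap_eq_of_eq_on_siteVec`);
* `exists_global_frame`: propagation from `X 0 = 0` along the three axes (9226's `exists_global_frame`);
* `add_sq_eq_of_frames`, `exists_adjacent_change`: ONE SPACING — if both site types occur, two adjacent layers
  have different types, and the vertical bond between them read from both ends gives `h₀ = a₀ √(2/3)`.

All `[folklore]`.
-/

noncomputable section

namespace Summit.AtomisticToContinuum.Crystallization.Theorems.PalmGoodLaw.FramePropagation

open Literature.MathematicalPhysics.StatisticalMechanics
open Summit.AtomisticToContinuum.Crystallization.Theorems.PalmUnimodularRigidity.LayeredLawsSelectHcp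

/-! ## Struts are lattice vectors -/

/-- **Every strut is a lattice vector**, for every spacing:
`barlowPos a h s k' i' j' − barlowPos a h s k i j = siteVec a h (2Δi + Δj + ΔL, 3Δj + ΔL, Δk)`. [folklore] -/
theorem strut_eq_siteVec (a h : ℝ) (s : ℤ → ℤ) (k i j k' i' j' : ℤ) :
    barlowPos a h s k' i' j' - barlowPos a h s k i j =
      siteVec a h (2 * (i' - i) + (j' - j) + (haggLabel s k' - haggLabel s k),
        3 * (j' - j) + (haggLabel s k' - haggLabel s k), k' - k) := by
  ext l; fin_cases l <;> simp [siteVec] <;> ring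

/-- `siteVec` is additive. [folklore] -/
theorem siteVec_add (a h : ℝ) (n n' : ℤ × ℤ × ℤ) :
    siteVec a h n + siteVec a h n' = siteVec a h (n + n') := by
  ext l; fin_cases l <;> simp [siteVec] <;> ring

/-- The squared length of a lattice vector: `a²/4 · n₁² + a²/12 · n₂² + h² · n₃²`. [folklore] -/
theorem norm_siteVec_sq (a h : ℝ) (n : ℤ × ℤ × ℤ) :
    ‖siteVec a h n‖ ^ 2 = a ^ 2 / 4 * (n.1 : ℝ) ^ 2 + a ^ 2 / 12 * (n.2.1 : ℝ) ^ 2 + h ^ 2 * (n.2.2 : ℝ) ^ 2 := by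
  have h3 : (√3 : ℝ) ^ 2 = 3 := Real.sq_sqrt (by norm_num)
  obtain ⟨e0, e1, e2⟩ := siteVec_apply a h n
  rw [EuclideanSpace.norm_sq_eq, Fin.sum_univ_three, Real.norm_eq_abs, Real.norm_eq_abs, Real.norm_eq_abs,
    sq_abs, sq_abs, sq_abs, e0, e1, e2]
  linear_combination (a ^ 2 * (n.2.1 : ℝ) ^ 2 / 36) * h3

/-- **Contacts from lattice vectors**: if the strut from `u` to `w` is the lattice vector `n` with
`3 n₁² + n₂² + 8 n₃² = 12`, then `u, w` are contacts of the ideal stacking. [folklore] -/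
theorem dist_eq_one_of_strut {s : ℤ → ℤ} {u w n : ℤ × ℤ × ℤ}
    (hn : ∀ a h : ℝ, barlowPos a h s w.1 w.2.1 w.2.2 - barlowPos a h s u.1 u.2.1 u.2.2 = siteVec a h n)
    (h12 : 3 * n.1 ^ 2 + n.2.1 ^ 2 + 8 * n.2.2 ^ 2 = 12) :
    dist (barlowPos 1 (Real.sqrt (2 / 3)) s u.1 u.2.1 u.2.2)
      (barlowPos 1 (Real.sqrt (2 / 3)) s w.1 w.2.1 w.2.2) = 1 := by
  have h23 : Real.sqrt (2 / 3) ^ 2 = 2 / 3 := Real.sq_sqrt (by norm_num)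
  have h12' : (3 : ℝ) * (n.1 : ℝ) ^ 2 + (n.2.1 : ℝ) ^ 2 + 8 * (n.2.2 : ℝ) ^ 2 = 12 := by exact_mod_cast h12
  have hsq : dist (barlowPos 1 (Real.sqrt (2 / 3)) s u.1 u.2.1 u.2.2)
      (barlowPos 1 (Real.sqrt (2 / 3)) s w.1 w.2.1 w.2.2) ^ 2 = 1 := by
    rw [dist_comm, dist_eq_norm, hn, norm_siteVec_sq, h23]
    linarith
  rwa [pow_eq_one_iff_of_nonneg dist_nonneg two_ne_zero] at hsq

/-! ## Frames agree along contacts -/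

/-- **Frames agree along a contact with two good common contacts.** If `A` is a frame at `u` and `B` one at
`w` (`X v − X u = A (R v − R u)` for the contacts `v` of `u`, similarly at `w`), the struts `u → w`, `w → c₁`,
`w → c₂` are the lattice vectors `n, m₁, m₂` with `n, m₁, m₂, n + m₁, n + m₂` all of ideal length `1` (so that
`u ~ w` and `c₁, c₂` are common contacts of `u` and `w`) and `det3 n m₁ m₂ ≠ 0`, then `A = B`: both agree on
`R w − R u`, `R c₁ − R w`, `R c₂ − R w`. [folklore] -/
theorem frame_agree_of {a h : ℝ} (ha : a ≠ 0) (hh : h ≠ 0) {s : ℤ → ℤ}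
    {X : ℤ × ℤ × ℤ → EuclideanSpace ℝ (Fin 3)} (u w c₁ c₂ n m₁ m₂ : ℤ × ℤ × ℤ)
    (hn : ∀ a h : ℝ, barlowPos a h s w.1 w.2.1 w.2.2 - barlowPos a h s u.1 u.2.1 u.2.2 = siteVec a h n)
    (hm₁ : ∀ a h : ℝ, barlowPos a h s c₁.1 c₁.2.1 c₁.2.2 - barlowPos a h s w.1 w.2.1 w.2.2 = siteVec a h m₁)
    (hm₂ : ∀ a h : ℝ, barlowPos a h s c₂.1 c₂.2.1 c₂.2.2 - barlowPos a h s w.1 w.2.1 w.2.2 = siteVec a h m₂)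
    (h0 : 3 * n.1 ^ 2 + n.2.1 ^ 2 + 8 * n.2.2 ^ 2 = 12)
    (h1 : 3 * m₁.1 ^ 2 + m₁.2.1 ^ 2 + 8 * m₁.2.2 ^ 2 = 12)
    (h2 : 3 * m₂.1 ^ 2 + m₂.2.1 ^ 2 + 8 * m₂.2.2 ^ 2 = 12)
    (h1' : 3 * (n + m₁).1 ^ 2 + (n + m₁).2.1 ^ 2 + 8 * (n + m₁).2.2 ^ 2 = 12)
    (h2' : 3 * (n + m₂).1 ^ 2 + (n + m₂).2.1 ^ 2 + 8 * (n + m₂).2.2 ^ 2 = 12)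
    (hdet : det3 n m₁ m₂ ≠ 0)
    {A B : EuclideanSpace ℝ (Fin 3) ≃ₗᵢ[ℝ] EuclideanSpace ℝ (Fin 3)}
    (hA : ∀ v : ℤ × ℤ × ℤ,
      dist (barlowPos 1 (Real.sqrt (2 / 3)) s u.1 u.2.1 u.2.2)
        (barlowPos 1 (Real.sqrt (2 / 3)) s v.1 v.2.1 v.2.2) = 1 →
      X v - X u = A (barlowPos a h s v.1 v.2.1 v.2.2 - barlowPos a h s u.1 u.2.1 u.2.2))
    (hB : ∀ v : ℤ × ℤ × ℤ,
      dist (barlowPos 1 (Real.sqrt (2 / 3)) s w.1 w.2.1 w.2.2)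
        (barlowPos 1 (Real.sqrt (2 / 3)) s v.1 v.2.1 v.2.2) = 1 →
      X v - X w = B (barlowPos a h s v.1 v.2.1 v.2.2 - barlowPos a h s w.1 w.2.1 w.2.2)) :
    A = B := by
  -- the struts from `u` to the common contacts
  have hk₁ : ∀ a h : ℝ, barlowPos a h s c₁.1 c₁.2.1 c₁.2.2 - barlowPos a h s u.1 u.2.1 u.2.2 =
      siteVec a h (n + m₁) := fun a h => by
    rw [← sub_add_sub_cancel (barlowPos a h s c₁.1 c₁.2.1 c₁.2.2) (barlowPos a h s w.1 w.2.1 w.2.2), hm₁, hn,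
      siteVec_add, add_comm]
  have hk₂ : ∀ a h : ℝ, barlowPos a h s c₂.1 c₂.2.1 c₂.2.2 - barlowPos a h s u.1 u.2.1 u.2.2 =
      siteVec a h (n + m₂) := fun a h => by
    rw [← sub_add_sub_cancel (barlowPos a h s c₂.1 c₂.2.1 c₂.2.2) (barlowPos a h s w.1 w.2.1 w.2.2), hm₂, hn,
      siteVec_add, add_comm]
  -- the contacts
  have cuw := dist_eq_one_of_strut hn h0
  have cw₁ := dist_eq_one_of_strut hm₁ h1
  have cw₂ := dist_eq_one_of_strut hm₂ h2
  have cu₁ := dist_eq_one_of_strut hk₁ h1'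
  have cu₂ := dist_eq_one_of_strut hk₂ h2'
  -- `A` and `B` agree on three vectors
  have e0 : A (barlowPos a h s w.1 w.2.1 w.2.2 - barlowPos a h s u.1 u.2.1 u.2.2) =
      B (barlowPos a h s w.1 w.2.1 w.2.2 - barlowPos a h s u.1 u.2.1 u.2.2) := by
    rw [← hA w cuw, ← neg_sub (X u) (X w), hB u (by rw [dist_comm]; exact cuw), ← map_neg, neg_sub]
  have e1 : A (barlowPos a h s c₁.1 c₁.2.1 c₁.2.2 - barlowPos a h s w.1 w.2.1 w.2.2) =
      B (barlowPos a h s c₁.1 c₁.2.1 c₁.2.2 - barlowPos a h s w.1 w.2.1 w.2.2) := by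
    rw [← hB c₁ cw₁, show X c₁ - X w = (X c₁ - X u) - (X w - X u) by abel, hA c₁ cu₁, hA w cuw, ← map_sub,
      sub_sub_sub_cancel_right]
  have e2 : A (barlowPos a h s c₂.1 c₂.2.1 c₂.2.2 - barlowPos a h s w.1 w.2.1 w.2.2) =
      B (barlowPos a h s c₂.1 c₂.2.1 c₂.2.2 - barlowPos a h s w.1 w.2.1 w.2.2) := by
    rw [← hB c₂ cw₂, show X c₂ - X w = (X c₂ - X u) - (X w - X u) by abel, hA c₂ cu₂, hA w cuw, ← map_sub,
      sub_sub_sub_cancel_right]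
  rw [hn a h] at e0
  rw [hm₁ a h] at e1
  rw [hm₂ a h] at e2
  have key : A.toLinearEquiv.toLinearMap = B.toLinearEquiv.toLinearMap :=
    linearMap_eq_of_eq_on_siteVec ha hh hdet (by simpa using e0) (by simpa using e1) (by simpa using e2)
  exact LinearIsometryEquiv.toLinearEquiv_injective (LinearEquiv.toLinearMap_injective key)

section Agree

variable {a h : ℝ} (ha : a ≠ 0) (hh : h ≠ 0) {s : ℤ → ℤ} (hs : IsHaggSeq s)
  {X : ℤ × ℤ × ℤ → EuclideanSpace ℝ (Fin 3)} (k i j : ℤ)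
  {A B : EuclideanSpace ℝ (Fin 3) ≃ₗᵢ[ℝ] EuclideanSpace ℝ (Fin 3)}
  (hA : ∀ v : ℤ × ℤ × ℤ,
    dist (barlowPos 1 (Real.sqrt (2 / 3)) s k i j) (barlowPos 1 (Real.sqrt (2 / 3)) s v.1 v.2.1 v.2.2) = 1 →
      X v - X (k, i, j) = A (barlowPos a h s v.1 v.2.1 v.2.2 - barlowPos a h s k i j))
include ha hh hs hA

/-- **Frames agree along the vertical step** `(k,i,j) ~ (k+1,i,j)`: the common contacts `(k+1, i−σ, j)`,
`(k+1, i, j−σ)` (`σ = s k`) give the lattice vectors `(σ,σ,1), (−2σ,0,0), (−σ,−3σ,0)` of determinant `6`.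
[folklore] -/
theorem frame_agree_vert
    (hB : ∀ v : ℤ × ℤ × ℤ,
      dist (barlowPos 1 (Real.sqrt (2 / 3)) s (k + 1) i j) (barlowPos 1 (Real.sqrt (2 / 3)) s v.1 v.2.1 v.2.2) = 1 →
        X v - X (k + 1, i, j) = B (barlowPos a h s v.1 v.2.1 v.2.2 - barlowPos a h s (k + 1) i j)) :
    A = B := by
  rcases hs k with hσ | hσ
  · exact frame_agree_of ha hh (k, i, j) (k + 1, i, j) (k + 1, i - 1, j) (k + 1, i, j - 1)
      (1, 1, 1) (-2, 0, 0) (-1, -3, 0)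
      (fun a h => by rw [strut_eq_siteVec]; congr 1; simp only [Prod.mk.injEq, haggLabel_succ, hσ]; omega)
      (fun a h => by rw [strut_eq_siteVec]; congr 1; simp only [Prod.mk.injEq]; omega)
      (fun a h => by rw [strut_eq_siteVec]; congr 1; simp only [Prod.mk.injEq]; omega)
      (by decide) (by decide) (by decide) (by decide) (by decide) (by decide) hA hB
  · exact frame_agree_of ha hh (k, i, j) (k + 1, i, j) (k + 1, i + 1, j) (k + 1, i, j + 1)
      (-1, -1, 1) (2, 0, 0) (1, 3, 0)
      (fun a h => by rw [strut_eq_siteVec]; congr 1; simp only [Prod.mk.injEq, haggLabel_succ, hσ]; omega)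
      (fun a h => by rw [strut_eq_siteVec]; congr 1; simp only [Prod.mk.injEq]; omega)
      (fun a h => by rw [strut_eq_siteVec]; congr 1; simp only [Prod.mk.injEq]; omega)
      (by decide) (by decide) (by decide) (by decide) (by decide) (by decide) hA hB

/-- **Frames agree along the axis step** `(k,i,j) ~ (k,i+1,j)`: the common contacts `(k, i, j+1)` and
`(k+1, i, j)` (`s k = 1`) resp. `(k+1, i+1, j)` (`s k = −1`) give the lattice vectors `(2,0,0), (−1,3,0),
(−1,σ,1)` of determinant `6`. [folklore] -/
theorem frame_agree_axis₁
    (hB : ∀ v : ℤ × ℤ × ℤ,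
      dist (barlowPos 1 (Real.sqrt (2 / 3)) s k (i + 1) j) (barlowPos 1 (Real.sqrt (2 / 3)) s v.1 v.2.1 v.2.2) = 1 →
        X v - X (k, i + 1, j) = B (barlowPos a h s v.1 v.2.1 v.2.2 - barlowPos a h s k (i + 1) j)) :
    A = B := by
  rcases hs k with hσ | hσ
  · exact frame_agree_of ha hh (k, i, j) (k, i + 1, j) (k, i, j + 1) (k + 1, i, j)
      (2, 0, 0) (-1, 3, 0) (-1, 1, 1)
      (fun a h => by rw [strut_eq_siteVec]; congr 1; simp only [Prod.mk.injEq]; omega)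
      (fun a h => by rw [strut_eq_siteVec]; congr 1; simp only [Prod.mk.injEq]; omega)
      (fun a h => by rw [strut_eq_siteVec]; congr 1; simp only [Prod.mk.injEq, haggLabel_succ, hσ]; omega)
      (by decide) (by decide) (by decide) (by decide) (by decide) (by decide) hA hB
  · exact frame_agree_of ha hh (k, i, j) (k, i + 1, j) (k, i, j + 1) (k + 1, i + 1, j)
      (2, 0, 0) (-1, 3, 0) (-1, -1, 1)
      (fun a h => by rw [strut_eq_siteVec]; congr 1; simp only [Prod.mk.injEq]; omega)
      (fun a h => by rw [strut_eq_siteVec]; congr 1; simp only [Prod.mk.injEq]; omega)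
      (fun a h => by rw [strut_eq_siteVec]; congr 1; simp only [Prod.mk.injEq, haggLabel_succ, hσ]; omega)
      (by decide) (by decide) (by decide) (by decide) (by decide) (by decide) hA hB

/-- **Frames agree along the axis step** `(k,i,j) ~ (k,i,j+1)`: the common contacts `(k, i+1, j)` and
`(k+1, i, j)` (`s k = 1`) resp. `(k+1, i, j+1)` (`s k = −1`) give the lattice vectors `(1,3,0), (1,−3,0)` and
`(0,−2,1)` resp. `(−1,−1,1)`, of determinant `−6`. [folklore] -/
theorem frame_agree_axis₂
    (hB : ∀ v : ℤ × ℤ × ℤ,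
      dist (barlowPos 1 (Real.sqrt (2 / 3)) s k i (j + 1)) (barlowPos 1 (Real.sqrt (2 / 3)) s v.1 v.2.1 v.2.2) = 1 →
        X v - X (k, i, j + 1) = B (barlowPos a h s v.1 v.2.1 v.2.2 - barlowPos a h s k i (j + 1))) :
    A = B := by
  rcases hs k with hσ | hσ
  · exact frame_agree_of ha hh (k, i, j) (k, i, j + 1) (k, i + 1, j) (k + 1, i, j)
      (1, 3, 0) (1, -3, 0) (0, -2, 1)
      (fun a h => by rw [strut_eq_siteVec]; congr 1; simp only [Prod.mk.injEq]; omega)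
      (fun a h => by rw [strut_eq_siteVec]; congr 1; simp only [Prod.mk.injEq]; omega)
      (fun a h => by rw [strut_eq_siteVec]; congr 1; simp only [Prod.mk.injEq, haggLabel_succ, hσ]; omega)
      (by decide) (by decide) (by decide) (by decide) (by decide) (by decide) hA hB
  · exact frame_agree_of ha hh (k, i, j) (k, i, j + 1) (k, i + 1, j) (k + 1, i, j + 1)
      (1, 3, 0) (1, -3, 0) (-1, -1, 1)
      (fun a h => by rw [strut_eq_siteVec]; congr 1; simp only [Prod.mk.injEq]; omega)
      (fun a h => by rw [strut_eq_siteVec]; congr 1; simp only [Prod.mk.injEq]; omega)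
      (fun a h => by rw [strut_eq_siteVec]; congr 1; simp only [Prod.mk.injEq, haggLabel_succ, hσ]; omega)
      (by decide) (by decide) (by decide) (by decide) (by decide) (by decide) hA hB

end Agree

/-! ## Propagation -/

/-- **Propagation** (9226's `exists_global_frame` for a general word): if EVERY site carries a frame against
`barlowPos a h s` (`a, h ≠ 0`) and `X 0 = 0`, one linear isometry `A` has `X u = A (barlowPos a h s u)` for all
`u` — frames agree along the vertical and the in-layer axis steps, which are contacts and connect `ℤ³`.
[folklore] -/
theorem exists_global_frame {a h : ℝ} (ha : a ≠ 0) (hh : h ≠ 0) {s : ℤ → ℤ} (hs : IsHaggSeq s)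
    {X : ℤ × ℤ × ℤ → EuclideanSpace ℝ (Fin 3)} (hX0 : X (0, 0, 0) = 0)
    (hloc : ∀ u : ℤ × ℤ × ℤ, ∃ A : EuclideanSpace ℝ (Fin 3) ≃ₗᵢ[ℝ] EuclideanSpace ℝ (Fin 3), ∀ w : ℤ × ℤ × ℤ,
      dist (barlowPos 1 (Real.sqrt (2 / 3)) s u.1 u.2.1 u.2.2)
        (barlowPos 1 (Real.sqrt (2 / 3)) s w.1 w.2.1 w.2.2) = 1 →
      X w - X u = A (barlowPos a h s w.1 w.2.1 w.2.2 - barlowPos a h s u.1 u.2.1 u.2.2)) :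
    ∃ A : EuclideanSpace ℝ (Fin 3) ≃ₗᵢ[ℝ] EuclideanSpace ℝ (Fin 3), ∀ u : ℤ × ℤ × ℤ,
      X u = A (barlowPos a h s u.1 u.2.1 u.2.2) := by
  choose Af hAf using hloc
  refine ⟨Af (0, 0, 0), ?_⟩
  -- one contact step
  have step : ∀ v w : ℤ × ℤ × ℤ,
      (X v = Af (0, 0, 0) (barlowPos a h s v.1 v.2.1 v.2.2) ∧ Af v = Af (0, 0, 0)) → Af v = Af w →
      dist (barlowPos 1 (Real.sqrt (2 / 3)) s v.1 v.2.1 v.2.2)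
        (barlowPos 1 (Real.sqrt (2 / 3)) s w.1 w.2.1 w.2.2) = 1 →
      (X w = Af (0, 0, 0) (barlowPos a h s w.1 w.2.1 w.2.2) ∧ Af w = Af (0, 0, 0)) := by
    rintro v w ⟨hXv, hAv⟩ heq hvw
    refine ⟨?_, by rw [← heq, hAv]⟩
    have e := hAf v w hvw; rw [hAv] at e
    calc X w = X v + (X w - X v) := by abel
      _ = Af (0, 0, 0) (barlowPos a h s v.1 v.2.1 v.2.2) +
          Af (0, 0, 0) (barlowPos a h s w.1 w.2.1 w.2.2 - barlowPos a h s v.1 v.2.1 v.2.2) := by rw [e, hXv]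
      _ = Af (0, 0, 0) (barlowPos a h s w.1 w.2.1 w.2.2) := by rw [map_sub]; abel
  -- the three axis steps are contacts, and the frames agree along them
  have cV : ∀ k i j : ℤ, dist (barlowPos 1 (Real.sqrt (2 / 3)) s k i j)
      (barlowPos 1 (Real.sqrt (2 / 3)) s (k + 1) i j) = 1 := fun k i j => by
    rw [dist_comm, dist_barlowPos_succ_eq (hs := hs), one_pow, Real.sq_sqrt (by norm_num : (0 : ℝ) ≤ 2 / 3)]
    norm_num
  have cI : ∀ k i j : ℤ, dist (barlowPos 1 (Real.sqrt (2 / 3)) s k i j)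
      (barlowPos 1 (Real.sqrt (2 / 3)) s k (i + 1) j) = 1 := fun k i j =>
    dist_eq_one_of_strut (u := (k, i, j)) (w := (k, i + 1, j)) (n := (2, 0, 0))
      (fun a h => by rw [strut_eq_siteVec]; congr 1; simp only [Prod.mk.injEq]; omega) (by decide)
  have cJ : ∀ k i j : ℤ, dist (barlowPos 1 (Real.sqrt (2 / 3)) s k i j)
      (barlowPos 1 (Real.sqrt (2 / 3)) s k i (j + 1)) = 1 := fun k i j =>
    dist_eq_one_of_strut (u := (k, i, j)) (w := (k, i, j + 1)) (n := (1, 3, 0))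
      (fun a h => by rw [strut_eq_siteVec]; congr 1; simp only [Prod.mk.injEq]; omega) (by decide)
  have aV : ∀ k i j : ℤ, Af (k, i, j) = Af (k + 1, i, j) := fun k i j =>
    frame_agree_vert ha hh hs k i j (hAf (k, i, j)) (hAf (k + 1, i, j))
  have aI : ∀ k i j : ℤ, Af (k, i, j) = Af (k, i + 1, j) := fun k i j =>
    frame_agree_axis₁ ha hh hs k i j (hAf (k, i, j)) (hAf (k, i + 1, j))
  have aJ : ∀ k i j : ℤ, Af (k, i, j) = Af (k, i, j + 1) := fun k i j =>
    frame_agree_axis₂ ha hh hs k i j (hAf (k, i, j)) (hAf (k, i, j + 1))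
  -- walk along the axes
  have hk : ∀ k : ℤ, X (k, 0, 0) = Af (0, 0, 0) (barlowPos a h s k 0 0) ∧ Af (k, 0, 0) = Af (0, 0, 0) := by
    intro k
    induction k using Int.induction_on with
    | zero =>
      have h0 : barlowPos a h s 0 0 0 = 0 := by ext l; fin_cases l <;> simp
      exact ⟨by rw [h0, map_zero, hX0], rfl⟩
    | succ n ih => exact step (n, 0, 0) (n + 1, 0, 0) ih (aV n 0 0) (cV n 0 0)
    | pred n ih =>
      have c := cV (-(n : ℤ) - 1) 0 0; have e := aV (-(n : ℤ) - 1) 0 0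
      rw [sub_add_cancel] at c e; rw [dist_comm] at c
      exact step (-(n : ℤ), 0, 0) (-(n : ℤ) - 1, 0, 0) ih e.symm c
  have hki : ∀ k i : ℤ, X (k, i, 0) = Af (0, 0, 0) (barlowPos a h s k i 0) ∧ Af (k, i, 0) = Af (0, 0, 0) := by
    intro k i
    induction i using Int.induction_on with
    | zero => exact hk k
    | succ n ih => exact step (k, (n : ℤ), 0) (k, n + 1, 0) ih (aI k n 0) (cI k n 0)
    | pred n ih =>
      have c := cI k (-(n : ℤ) - 1) 0; have e := aI k (-(n : ℤ) - 1) 0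
      rw [sub_add_cancel] at c e; rw [dist_comm] at c
      exact step (k, -(n : ℤ), 0) (k, -(n : ℤ) - 1, 0) ih e.symm c
  intro u
  obtain ⟨k, i, j⟩ := u
  suffices H : X (k, i, j) = Af (0, 0, 0) (barlowPos a h s k i j) ∧ Af (k, i, j) = Af (0, 0, 0) from H.1
  induction j using Int.induction_on with
  | zero => exact hki k i
  | succ n ih => exact step (k, i, (n : ℤ)) (k, i, n + 1) ih (aJ k i n) (cJ k i n)
  | pred n ih =>
    have c := cJ k i (-(n : ℤ) - 1); have e := aJ k i (-(n : ℤ) - 1)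
    rw [sub_add_cancel] at c e; rw [dist_comm] at c
    exact step (k, i, -(n : ℤ)) (k, i, -(n : ℤ) - 1) ih e.symm c

/-! ## One spacing -/

/-- **The vertical bond read from both ends**: if the site `(k,i,j)` carries a frame against the spacing
`(a, h)` and the site `(k+1,i,j)` one against `(a, h')`, then `a²/3 + h² = a²/3 + h'²` (both are
`‖X (k+1,i,j) − X (k,i,j)‖²`, `dist_barlowPos_succ_eq`). [folklore] -/
theorem add_sq_eq_of_frames {a h h' : ℝ} {s : ℤ → ℤ} (hs : IsHaggSeq s)
    {X : ℤ × ℤ × ℤ → EuclideanSpace ℝ (Fin 3)} (k i j : ℤ)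
    {A B : EuclideanSpace ℝ (Fin 3) ≃ₗᵢ[ℝ] EuclideanSpace ℝ (Fin 3)}
    (hA : ∀ w : ℤ × ℤ × ℤ,
      dist (barlowPos 1 (Real.sqrt (2 / 3)) s k i j) (barlowPos 1 (Real.sqrt (2 / 3)) s w.1 w.2.1 w.2.2) = 1 →
        X w - X (k, i, j) = A (barlowPos a h s w.1 w.2.1 w.2.2 - barlowPos a h s k i j))
    (hB : ∀ w : ℤ × ℤ × ℤ,
      dist (barlowPos 1 (Real.sqrt (2 / 3)) s (k + 1) i j) (barlowPos 1 (Real.sqrt (2 / 3)) s w.1 w.2.1 w.2.2) = 1 →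
        X w - X (k + 1, i, j) = B (barlowPos a h' s w.1 w.2.1 w.2.2 - barlowPos a h' s (k + 1) i j)) :
    a ^ 2 / 3 + h ^ 2 = a ^ 2 / 3 + h' ^ 2 := by
  have c : dist (barlowPos 1 (Real.sqrt (2 / 3)) s k i j) (barlowPos 1 (Real.sqrt (2 / 3)) s (k + 1) i j) = 1 := by
    rw [dist_comm, dist_barlowPos_succ_eq (hs := hs), one_pow, Real.sq_sqrt (by norm_num : (0 : ℝ) ≤ 2 / 3)]
    norm_num
  have e1 := hA (k + 1, i, j) c
  have e2 := hB (k, i, j) (by rw [dist_comm]; exact c)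
  dsimp only at e1 e2
  have n1 : ‖X (k + 1, i, j) - X (k, i, j)‖ = √(a ^ 2 / 3 + h ^ 2) := by
    rw [e1, LinearIsometryEquiv.norm_map, ← dist_eq_norm, dist_barlowPos_succ_eq (hs := hs)]
  have n2 : ‖X (k + 1, i, j) - X (k, i, j)‖ = √(a ^ 2 / 3 + h' ^ 2) := by
    rw [norm_sub_rev, e2, LinearIsometryEquiv.norm_map, ← dist_eq_norm, dist_comm,
      dist_barlowPos_succ_eq (hs := hs)]
  rw [n1] at n2
  exact (Real.sqrt_inj (by positivity) (by positivity)).1 n2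

/-- **Discrete intermediate value on `ℤ`**: a predicate holding at one integer and failing at another changes
between two consecutive integers. [folklore] -/
theorem exists_adjacent_change {p : ℤ → Prop} {k₁ k₂ : ℤ} (h₁ : p k₁) (h₂ : ¬p k₂) :
    ∃ m : ℤ, (p m ∧ ¬p (m + 1)) ∨ (¬p m ∧ p (m + 1)) := by
  by_contra H
  push Not at H
  have hiff : ∀ m, p m ↔ p (m + 1) := fun m => ⟨(H m).1, fun h => by_contra fun hm => (H m).2 hm h⟩
  have hall : ∀ n : ℤ, p (k₁ + n) ↔ p k₁ := by
    intro n
    induction n using Int.induction_on with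
    | zero => rw [add_zero]
    | succ n ih => rw [← add_assoc, ← hiff]; exact ih
    | pred n ih => rw [hiff, show k₁ + (-(n : ℤ) - 1) + 1 = k₁ + -(n : ℤ) by ring]; exact ih
  have := (hall (k₂ - k₁)).2 h₁
  rw [add_sub_cancel] at this
  exact h₂ this

/-! ## The registered stub -/

/-- **Stub `stub_framePropagation` (X2c of line `palm-good-law`): frames agree and propagate.**  Let `s` be a
Hägg word and `X : ℤ × ℤ × ℤ → ℝ³` with `X 0 = 0` carry, at every h-type site, a label-exact frame against
`barlowPos a₀ h₀ s` and, at every c-type site, one against `barlowPos a₀ (a₀ √(2/3)) s`.  Then there are ONE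
spacing `h ∈ {h₀, a₀ √(2/3)}` and ONE linear isometry `A` with `X u = A (barlowPos a₀ h s u)` for all `u`.
(i) ONE SPACING: if only one site type occurs take `h = h₀` resp. `h = a₀ √(2/3)`; if both occur, two adjacent
layers `m, m+1` have different types (`exists_adjacent_change`) and the vertical bond between `(m,0,0)` and
`(m+1,0,0)` read from both ends gives `h₀² = (a₀ √(2/3))²` (`add_sq_eq_of_frames`), so `h₀ = a₀ √(2/3)` and every
site has a frame against `barlowPos a₀ h₀ s`; (ii)+(iii) `exists_global_frame`. [folklore] -/
theorem stub_framePropagation :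
    ∀ a₀ h₀ : ℝ, 189 / 200 ≤ a₀ → a₀ ≤ 199 / 200 → 77 / 100 ≤ h₀ → h₀ ≤ 163 / 200 →
      ∀ s : ℤ → ℤ, IsHaggSeq s →
      ∀ X : ℤ × ℤ × ℤ → EuclideanSpace ℝ (Fin 3), X (0, 0, 0) = 0 →
        (∀ u : ℤ × ℤ × ℤ, s (u.1 - 1) ≠ s u.1 →
          ∃ A : EuclideanSpace ℝ (Fin 3) ≃ₗᵢ[ℝ] EuclideanSpace ℝ (Fin 3), ∀ w : ℤ × ℤ × ℤ,
            dist (barlowPos 1 (Real.sqrt (2 / 3)) s u.1 u.2.1 u.2.2) (barlowPos 1 (Real.sqrt (2 / 3)) s w.1 w.2.1 w.2.2) = 1 →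
            X w - X u = A (barlowPos a₀ h₀ s w.1 w.2.1 w.2.2 - barlowPos a₀ h₀ s u.1 u.2.1 u.2.2)) →
        (∀ u : ℤ × ℤ × ℤ, s (u.1 - 1) = s u.1 →
          ∃ A : EuclideanSpace ℝ (Fin 3) ≃ₗᵢ[ℝ] EuclideanSpace ℝ (Fin 3), ∀ w : ℤ × ℤ × ℤ,
            dist (barlowPos 1 (Real.sqrt (2 / 3)) s u.1 u.2.1 u.2.2) (barlowPos 1 (Real.sqrt (2 / 3)) s w.1 w.2.1 w.2.2) = 1 →
            X w - X u = A (barlowPos a₀ (a₀ * Real.sqrt (2 / 3)) s w.1 w.2.1 w.2.2 -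
              barlowPos a₀ (a₀ * Real.sqrt (2 / 3)) s u.1 u.2.1 u.2.2)) →
        ∃ h : ℝ, (h = h₀ ∨ h = a₀ * Real.sqrt (2 / 3)) ∧
          ∃ A : EuclideanSpace ℝ (Fin 3) ≃ₗᵢ[ℝ] EuclideanSpace ℝ (Fin 3), ∀ u : ℤ × ℤ × ℤ,
            X u = A (barlowPos a₀ h s u.1 u.2.1 u.2.2) := by
  intro a₀ h₀ ha₁ _ hh₁ _ s hs X hX0 hH hC
  have ha0 : 0 < a₀ := by linarith
  have hh0 : 0 < h₀ := by linarith
  have hr0 : 0 < Real.sqrt (2 / 3) := Real.sqrt_pos.2 (by norm_num)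
  have hc0 : 0 < a₀ * Real.sqrt (2 / 3) := mul_pos ha0 hr0
  by_cases hallH : ∀ k : ℤ, s (k - 1) ≠ s k
  · exact ⟨h₀, Or.inl rfl, exists_global_frame ha0.ne' hh0.ne' hs hX0 fun u => hH u (hallH u.1)⟩
  by_cases hallC : ∀ k : ℤ, s (k - 1) = s k
  · exact ⟨a₀ * Real.sqrt (2 / 3), Or.inr rfl,
      exists_global_frame ha0.ne' hc0.ne' hs hX0 fun u => hC u (hallC u.1)⟩
  push Not at hallH hallC
  obtain ⟨k₁, hk₁⟩ := hallH
  obtain ⟨k₂, hk₂⟩ := hallC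
  obtain ⟨m, hm⟩ := exists_adjacent_change (p := fun k => s (k - 1) = s k) hk₁ hk₂
  -- two adjacent layers of different types: the spacings coincide
  have hsq : a₀ ^ 2 / 3 + h₀ ^ 2 = a₀ ^ 2 / 3 + (a₀ * Real.sqrt (2 / 3)) ^ 2 := by
    rcases hm with ⟨h1, h2⟩ | ⟨h1, h2⟩
    · obtain ⟨A, hA⟩ := hC (m, 0, 0) h1
      obtain ⟨B, hB⟩ := hH (m + 1, 0, 0) h2
      exact (add_sq_eq_of_frames hs m 0 0 hA hB).symm
    · obtain ⟨A, hA⟩ := hH (m, 0, 0) h1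
      obtain ⟨B, hB⟩ := hC (m + 1, 0, 0) h2
      exact add_sq_eq_of_frames hs m 0 0 hA hB
  have heq : h₀ = a₀ * Real.sqrt (2 / 3) := by
    have h2 : h₀ ^ 2 = (a₀ * Real.sqrt (2 / 3)) ^ 2 := by linarith
    exact (sq_eq_sq₀ hh0.le hc0.le).1 h2
  refine ⟨h₀, Or.inl rfl, exists_global_frame ha0.ne' hh0.ne' hs hX0 fun u => ?_⟩
  by_cases hu : s (u.1 - 1) = s u.1
  · rw [heq]; exact hC u hu
  · exact hH u hu

end Summit.AtomisticToContinuum.Crystallization.Theorems.PalmGoodLaw.FramePropagation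

end
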